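import Mathlib
import HarnessLib
import Summits.Ventures.LatticeQCDFlow.Scoring.SelfNormalisedReweightingConsistency

/-!
# The HISTOGRAM column at `ε = 0`: the reweighted histogram of a discrete statistic (e.g. the
# topological charge `Q ∈ ℤ`) printed from one growing proposal stream converges almost surely
# to the target law — bin by bin, simultaneously for all bins, and in TOTAL VARIATION — with no
# moment hypothesis

HONEST FRAMING: exact (Metropolis-corrected) sampling algorithms for lattice gauge theory;
figures of merit are autocorrelation/cost numbers at stated couplings and volumes; no
continuum-physics claim.

Venture `LatticeQCDFlow` (cell pub-lqcd), topic `Scoring`; FANOUT row 4 (`s0-u1-b`, rung S0-B).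
Sequel of `Scoring/SelfNormalisedReweightingConsistency` (imported: the printed self-normalised
estimate of an observable with `p·O ∈ L¹(μ)` is strongly consistent).  A flow code reweights its
proposals `y₀, y₁, …` (independent, laws `ν = q dμ`, UNNORMALISED weights `w̃ = c·p/q`, `c > 0`)
into a histogram of a DISCRETE statistic `Q : X → K` (`K` countable — the topological charge
`Q ∈ ℤ`, a sector label, a bin index): bin `k` receives
`π̂ₙ(k) = Σ_{i<n} w̃ᵢ·1{Q(yᵢ) = k} / Σ_{i<n} w̃ᵢ`.  Its population counterpart is the target law of
`Q`, `π(k) = ∫ p·1{Q = k} dμ`.  Each indicator is a bounded observable, so the previous file gives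
`π̂ₙ(k) → π(k)` almost surely for each `k`, hence (countable intersection) for ALL `k` at once;
and since `π̂ₙ` (once `Σ w̃ᵢ > 0`) and `π` are probability vectors, bin-wise convergence upgrades
to TOTAL VARIATION, `Σ_k |π̂ₙ(k) − π(k)| → 0`, by Scheffé's identity
`Σ|π̂ − π| = 2Σ(π − π̂)⁺` and Tannery's dominated convergence for series (Mathlib's
`tendsto_tsum_of_dominated_convergence`, dominating sequence `π` itself).  Inputs: `p ≥ 0`,
`∫ p = 1`, `q > 0`, `Q` measurable — nothing else (the ESS may be `0`).  NEW WORK of the cell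
(elementary); no definition is introduced; nothing is cited as a fact (Scheffé 1947 and the
weighted-empirical-measure folklore NAMED ONLY).

## Content (`K` countable with measurable singletons; `π(k) = ∫ p·1{Q = k} dμ`)

* §1 deterministic: `abs_sub_eq_add_two_mul_posPart`, **`tsum_abs_sub_eq_two_mul_tsum_posPart`**
  (two vectors with `HasSum · 1`: `Σ'|b − a| = 2Σ'(a − b)⁺`), **`tsum_posPart_sub_tendsto_zero`**
  (Tannery: `a` summable, `a, bₙ ≥ 0`, `bₙ → a` bin-wise ⇒ `Σ'(a − bₙ)⁺ → 0`),
  `tsum_abs_sub_tendsto_zero` (⇒ `Σ'|bₙ − a| → 0` once `bₙ` are eventually probability vectors);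
* §2 the target law of `Q`: `measurable_binIndicator`, `integrable_target_binIndicator`,
  **`hasSum_targetBin`** (`HasSum π 1`, via the probability measure `p dμ` pushed forward by `Q`
  and `Measure.toPMF`), `targetBin_nonneg`;
* §3 the printed histogram: `hasSum_printedHistogram` (`HasSum π̂ₙ 1` whenever `Σ w̃ᵢ ≠ 0`),
  `printedHistogram_nonneg`, **`reweightedHistogram_tendsto_ae`** (all bins at once, a.s., any
  `c ≠ 0`), **`reweightedHistogram_tendsto_totalVariation_ae`** (`Σ'_k |π̂ₙ(k) − π(k)| → 0` a.s.,
  `c > 0`).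

NOT CLAIMED: any rate (a Dvoretzky–Kiefer–Wolfowitz / Bretagnolle–Huber-type bound would need the
moment ladder of row 4's median-of-blocks files); continuous statistics (Glivenko–Cantelli for
the reweighted empirical CDF); any number of ours re-scored.
-/

noncomputable section

namespace Summit.Ventures.LatticeQCDFlow.Scoring.CardConsistency

open MeasureTheory ProbabilityTheory Finset Real Filter
open scoped Topology Function ENNReal

/-! ## §1 Deterministic: Scheffé's identity and Tannery's theorem for probability vectors -/

section Scheffe

variable {K : Type*}

/-- `|b − a| = (b − a) + 2(a − b)⁺`. [folklore] -/
theorem abs_sub_eq_add_two_mul_posPart (a b : ℝ) : |b - a| = (b - a) + 2 * max (a - b) 0 := by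
  rcases le_or_gt a b with h | h
  · rw [abs_of_nonneg (by linarith), max_eq_right (by linarith)]
    ring
  · rw [abs_of_neg (by linarith), max_eq_left (by linarith)]
    ring

/-- **Scheffé's identity for probability vectors**: `HasSum a 1`, `HasSum b 1` ⇒
`Σ'|b − a| = 2Σ'(a − b)⁺`. [folklore] -/
theorem tsum_abs_sub_eq_two_mul_tsum_posPart {a b : K → ℝ} (ha : HasSum a 1) (hb : HasSum b 1) :
    ∑' k, |b k - a k| = 2 * ∑' k, max (a k - b k) 0 := by
  have hs : Summable fun k => b k - a k := hb.summable.sub ha.summable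
  have hpos : Summable fun k => max (a k - b k) 0 :=
    Summable.of_nonneg_of_le (fun k => le_max_right _ _)
      (fun k => max_le ((le_abs_self _).trans (abs_sub_comm (a k) (b k)).le) (abs_nonneg _))
      hs.abs
  have e : (fun k => |b k - a k|) = fun k => (b k - a k) + 2 * max (a k - b k) 0 :=
    funext fun k => abs_sub_eq_add_two_mul_posPart (a k) (b k)
  rw [e, hs.tsum_add (hpos.mul_left 2), tsum_mul_left, hb.summable.tsum_sub ha.summable,
    hb.tsum_eq, ha.tsum_eq, sub_self, zero_add]

/-- **Tannery for probability vectors**: `a ≥ 0` summable, `bₙ ≥ 0`, `bₙ(k) → a(k)` for every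
`k` ⇒ `Σ'_k (a(k) − bₙ(k))⁺ → 0` (dominating sequence `a`). [ours] -/
theorem tsum_posPart_sub_tendsto_zero {a : K → ℝ} {b : ℕ → K → ℝ} (ha : Summable a)
    (ha0 : ∀ k, 0 ≤ a k) (hb0 : ∀ n k, 0 ≤ b n k)
    (hlim : ∀ k, Tendsto (fun n => b n k) atTop (𝓝 (a k))) :
    Tendsto (fun n => ∑' k, max (a k - b n k) 0) atTop (𝓝 0) := by
  have h := tendsto_tsum_of_dominated_convergence (𝓕 := atTop)
    (f := fun n k => max (a k - b n k) 0) (g := fun k => max (a k - a k) 0) (bound := a) ha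
    (fun k => ((tendsto_const_nhds.sub (hlim k)).max tendsto_const_nhds))
    (Eventually.of_forall fun n k => by
      rw [Real.norm_of_nonneg (le_max_right _ _)]
      exact max_le (by linarith [hb0 n k]) (ha0 k))
  simpa only [sub_self, max_self, tsum_zero] using h

/-- **Bin-wise convergence of probability vectors is total-variation convergence**: `HasSum a 1`,
`a ≥ 0`, `bₙ ≥ 0`, eventually `HasSum bₙ 1`, `bₙ(k) → a(k)` for every `k` ⇒
`Σ'_k |bₙ(k) − a(k)| → 0`. [folklore: Scheffé] -/
theorem tsum_abs_sub_tendsto_zero {a : K → ℝ} {b : ℕ → K → ℝ} (ha : HasSum a 1)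
    (ha0 : ∀ k, 0 ≤ a k) (hb : ∀ᶠ n in atTop, HasSum (b n) 1) (hb0 : ∀ n k, 0 ≤ b n k)
    (hlim : ∀ k, Tendsto (fun n => b n k) atTop (𝓝 (a k))) :
    Tendsto (fun n => ∑' k, |b n k - a k|) atTop (𝓝 0) := by
  have h := (tsum_posPart_sub_tendsto_zero ha.summable ha0 hb0 hlim).const_mul 2
  rw [mul_zero] at h
  refine h.congr' ?_
  filter_upwards [hb] with n hn
  exact (tsum_abs_sub_eq_two_mul_tsum_posPart ha hn).symm

end Scheffe

/-! ## §2 The target law of a discrete statistic -/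

section Target

variable {X : Type*} [MeasurableSpace X] {μ : Measure X} {p : X → ℝ}
variable {K : Type*} [DecidableEq K] {Q : X → K}

/-- The bin indicator `1{Q = k}` is measurable. [folklore] -/
theorem measurable_binIndicator [MeasurableSpace K] [MeasurableSingletonClass K]
    (hQ : Measurable Q) (k : K) : Measurable fun z => if Q z = k then (1 : ℝ) else 0 :=
  Measurable.ite (hQ (measurableSet_singleton k)) measurable_const measurable_const

/-- `p·1{Q = k} ∈ L¹(μ)` for an integrable target. [folklore] -/
theorem integrable_target_binIndicator [MeasurableSpace K] [MeasurableSingletonClass K]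
    (hpm : Measurable p) (hpi : Integrable p μ) (hQ : Measurable Q) (k : K) :
    Integrable (fun z => p z * (if Q z = k then (1 : ℝ) else 0)) μ := by
  refine Integrable.mono' hpi.norm ((hpm.mul (measurable_binIndicator hQ k)).aestronglyMeasurable)
    (Filter.Eventually.of_forall fun z => ?_)
  rw [Real.norm_eq_abs, Real.norm_eq_abs, abs_mul]
  refine mul_le_of_le_one_right (abs_nonneg _) ?_
  split_ifs <;> simp

/-- `π(k) = ∫ p·1{Q = k} dμ ≥ 0` for `p ≥ 0`. [folklore] -/
theorem targetBin_nonneg (hp0 : ∀ z, 0 ≤ p z) (k : K) :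
    0 ≤ ∫ z, p z * (if Q z = k then (1 : ℝ) else 0) ∂μ :=
  integral_nonneg fun z => mul_nonneg (hp0 z) (by split_ifs <;> norm_num)

/-- **The target law of `Q` is a probability vector**: `p ≥ 0` measurable with `∫ p dμ = 1`,
`Q` measurable into a countable space ⇒ `HasSum (k ↦ ∫ p·1{Q = k} dμ) 1`. [ours] (the
probability measure `p dμ` pushed forward by `Q`, read through `Measure.toPMF`) -/
theorem hasSum_targetBin [MeasurableSpace K] [MeasurableSingletonClass K] [Countable K]
    (hp0 : ∀ z, 0 ≤ p z) (hpm : Measurable p) (hpi : Integrable p μ) (hp1 : ∫ z, p z ∂μ = 1)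
    (hQ : Measurable Q) :
    HasSum (fun k => ∫ z, p z * (if Q z = k then (1 : ℝ) else 0) ∂μ) 1 := by
  set ρ : Measure X := μ.withDensity fun z => ENNReal.ofReal (p z) with hρ
  haveI hρ1 : IsProbabilityMeasure ρ := by
    refine ⟨?_⟩
    rw [hρ, withDensity_apply _ MeasurableSet.univ, Measure.restrict_univ,
      ← ofReal_integral_eq_lintegral_ofReal hpi (Filter.Eventually.of_forall hp0), hp1,
      ENNReal.ofReal_one]
  haveI : IsProbabilityMeasure (ρ.map Q) := Measure.isProbabilityMeasure_map hQ.aemeasurable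
  -- each bin probability is the mass of a singleton under the push-forward law
  have hbin : ∀ k, ∫ z, p z * (if Q z = k then (1 : ℝ) else 0) ∂μ = ((ρ.map Q) {k}).toReal := by
    intro k
    have e1 : (fun z => p z * (if Q z = k then (1 : ℝ) else 0))
        = fun z => (if Q z = k then (1 : ℝ) else 0) * p z := funext fun z => mul_comm _ _
    have e2 : (fun z => if Q z = k then (1 : ℝ) else 0) = (Q ⁻¹' {k}).indicator 1 := by
      funext z
      by_cases h : Q z = k <;> simp [h]
    rw [e1, ← AllPairsVariance.integral_withDensity_eq' hp0 hpm, e2,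
      integral_indicator_one (hQ (measurableSet_singleton k)), Measure.real,
      Measure.map_apply hQ (measurableSet_singleton k)]
  have hP := (ρ.map Q).toPMF.hasSum_coe_one
  have hP' : HasSum (fun k => ((ρ.map Q) {k})) 1 := by
    have e : (fun k => (ρ.map Q) {k}) = ⇑((ρ.map Q).toPMF) :=
      funext fun k => (Measure.toPMF_apply (ρ.map Q) k).symm
    rw [e]
    exact hP
  have hne : ∀ k, (ρ.map Q) {k} ≠ ∞ := fun k => measure_ne_top _ _
  have hsum : Summable fun k => ((ρ.map Q) {k}).toReal :=
    ENNReal.summable_toReal (by rw [hP'.tsum_eq]; exact ENNReal.one_ne_top)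
  have htot : ∑' k, ((ρ.map Q) {k}).toReal = 1 := by
    rw [← ENNReal.tsum_toReal_eq hne, hP'.tsum_eq, ENNReal.toReal_one]
  have h := hsum.hasSum
  rw [htot] at h
  simpa only [hbin] using h

end Target

/-! ## §3 The printed reweighted histogram of one proposal stream -/

section Printed

variable {Ω : Type*} [MeasurableSpace Ω] {P : Measure Ω}
variable {X : Type*} [MeasurableSpace X] {μ : Measure X} {p q : X → ℝ} {y : ℕ → Ω → X}
variable {K : Type*} [DecidableEq K] {Q : X → K}

omit [MeasurableSpace Ω] [MeasurableSpace X] in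
/-- **The printed histogram is a probability vector** whenever the block has positive total
weight: `HasSum (k ↦ Σᵢ w̃ᵢ·1{Q(yᵢ) = k}/Σᵢ w̃ᵢ) 1` for `Σᵢ w̃ᵢ ≠ 0`. [ours] -/
theorem hasSum_printedHistogram {wt : X → ℝ} (n : ℕ) (ω : Ω)
    (hD : ∑ i ∈ range n, wt (y i ω) ≠ 0) :
    HasSum (fun k => (∑ i ∈ range n, wt (y i ω) * (if Q (y i ω) = k then (1 : ℝ) else 0))
      / (∑ i ∈ range n, wt (y i ω))) 1 := by
  have h : HasSum (fun k => ∑ i ∈ range n, wt (y i ω) * (if Q (y i ω) = k then (1 : ℝ) else 0))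
      (∑ i ∈ range n, wt (y i ω)) := by
    refine hasSum_sum fun i _ => ?_
    have e : (fun k => wt (y i ω) * (if Q (y i ω) = k then (1 : ℝ) else 0))
        = fun k => if Q (y i ω) = k then wt (y i ω) else 0 := funext fun k => mul_boole _ _
    rw [e]
    exact hasSum_ite_eq' (Q (y i ω)) (wt (y i ω))
  have h' := h.div_const (∑ i ∈ range n, wt (y i ω))
  rwa [div_self hD] at h'

omit [MeasurableSpace Ω] [MeasurableSpace X] in
/-- The printed histogram has non-negative bins when the weights are non-negative
(`w̃ = c·p/q`, `c ≥ 0`, `p ≥ 0`, `q > 0`). [ours] -/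
theorem printedHistogram_nonneg {wt : X → ℝ} (hwt0 : ∀ z, 0 ≤ wt z) (n : ℕ) (ω : Ω) (k : K) :
    0 ≤ (∑ i ∈ range n, wt (y i ω) * (if Q (y i ω) = k then (1 : ℝ) else 0))
      / (∑ i ∈ range n, wt (y i ω)) :=
  div_nonneg (sum_nonneg fun i _ => mul_nonneg (hwt0 _) (by split_ifs <;> norm_num))
    (sum_nonneg fun i _ => hwt0 _)

/-- **THE REWEIGHTED HISTOGRAM IS STRONGLY CONSISTENT, ALL BINS AT ONCE.**  One independent
proposal stream `yᵢ` (laws `μ.withDensity q`); `p` measurable, integrable, `∫ p dμ = 1`; `q > 0`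
measurable; `Q : X → K` measurable, `K` countable; weights printed with ANY normalisation
`w̃ = c·p/q`, `c ≠ 0`.  Then almost surely, for EVERY bin `k` simultaneously,
`π̂ₙ(k) = Σ_{i<n} w̃ᵢ·1{Q(yᵢ) = k}/Σ_{i<n} w̃ᵢ → π(k) = ∫ p·1{Q = k} dμ`. [ours] -/
theorem reweightedHistogram_tendsto_ae [MeasurableSpace K] [MeasurableSingletonClass K]
    [Countable K] (hym : ∀ j, Measurable (y j)) (hind : iIndepFun y P)
    (hlaw : ∀ j, Measure.map (y j) P = μ.withDensity fun z => ENNReal.ofReal (q z))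
    (hpm : Measurable p) (hpi : Integrable p μ) (hp1 : ∫ z, p z ∂μ = 1) (hq0 : ∀ z, 0 < q z)
    (hqm : Measurable q) (hQ : Measurable Q) {wt : X → ℝ} {c : ℝ} (hc : c ≠ 0)
    (hwt : ∀ z, wt z = c * (p z / q z)) :
    ∀ᵐ ω ∂P, ∀ k : K, Tendsto (fun n : ℕ =>
        (∑ i ∈ range n, wt (y i ω) * (if Q (y i ω) = k then (1 : ℝ) else 0))
          / (∑ i ∈ range n, wt (y i ω))) atTop
      (𝓝 (∫ z, p z * (if Q z = k then (1 : ℝ) else 0) ∂μ)) := by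
  rw [ae_all_iff]
  intro k
  exact selfNormReweighting_tendsto_ae hym hind hlaw hpm hpi hp1 hq0 hqm
    (measurable_binIndicator hQ k) (integrable_target_binIndicator hpm hpi hQ k) hc hwt

/-- **THE REWEIGHTED HISTOGRAM CONVERGES IN TOTAL VARIATION, ALMOST SURELY.**  Same stream and
model with `p ≥ 0` and `c > 0` (non-negative printed weights): almost surely
`Σ'_k |π̂ₙ(k) − π(k)| → 0` — the printed histogram of the charge (or of any discrete statistic) is
uniformly consistent over all sets of bins, with no moment hypothesis. [ours] -/
theorem reweightedHistogram_tendsto_totalVariation_ae [MeasurableSpace K]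
    [MeasurableSingletonClass K] [Countable K] [IsProbabilityMeasure P]
    (hym : ∀ j, Measurable (y j)) (hind : iIndepFun y P)
    (hlaw : ∀ j, Measure.map (y j) P = μ.withDensity fun z => ENNReal.ofReal (q z))
    (hp0 : ∀ z, 0 ≤ p z) (hpm : Measurable p) (hpi : Integrable p μ) (hp1 : ∫ z, p z ∂μ = 1)
    (hq0 : ∀ z, 0 < q z) (hqm : Measurable q) (hQ : Measurable Q) {wt : X → ℝ} {c : ℝ}
    (hc : 0 < c) (hwt : ∀ z, wt z = c * (p z / q z)) :
    ∀ᵐ ω ∂P, Tendsto (fun n : ℕ => ∑' k : K,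
        |(∑ i ∈ range n, wt (y i ω) * (if Q (y i ω) = k then (1 : ℝ) else 0))
            / (∑ i ∈ range n, wt (y i ω))
          - ∫ z, p z * (if Q z = k then (1 : ℝ) else 0) ∂μ|) atTop (𝓝 0) := by
  have hwt0 : ∀ z, 0 ≤ wt z := fun z => by
    rw [hwt]
    exact mul_nonneg hc.le (div_nonneg (hp0 z) (hq0 z).le)
  have hπ := hasSum_targetBin (μ := μ) hp0 hpm hpi hp1 hQ
  filter_upwards [reweightedHistogram_tendsto_ae hym hind hlaw hpm hpi hp1 hq0 hqm hQ hc.ne' hwt,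
    unnormalisedMeanWeight_tendsto_ae hym hind hlaw hpm hpi hp1 hq0 hqm hwt] with ω hbin hW
  -- eventually the printed total weight is positive, so the histogram is a probability vector
  have hD : ∀ᶠ n : ℕ in atTop, ∑ i ∈ range n, wt (y i ω) ≠ 0 := by
    have hpos : ∀ᶠ n : ℕ in atTop, c / 2 < (∑ i ∈ range n, wt (y i ω)) / n :=
      hW.eventually_const_lt (by linarith)
    filter_upwards [hpos, eventually_ge_atTop 1] with n hn hn1 hzero
    rw [hzero, zero_div] at hn
    linarith
  refine tsum_abs_sub_tendsto_zero hπ (targetBin_nonneg hp0)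
    (hD.mono fun n hn => hasSum_printedHistogram n ω hn)
    (fun n k => printedHistogram_nonneg hwt0 n ω k) hbin

end Printed

end Summit.Ventures.LatticeQCDFlow.Scoring.CardConsistency

end
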